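import Literature.AlgebraicGeometry.Resolution.BlowupResolutionCriterion
import Literature.AlgebraicGeometry.Resolution.LogRegularBlowupCriterion
import Literature.AlgebraicGeometry.Resolution.LogRegularAtlas
import HarnessLib

/-!
# Resolution by one blowing up from CHART data: gluing compatible chart ideals
# (the scheme side of Kato 1994 (10.4) in its atlas form)

Topic: `Literature/AlgebraicGeometry/Resolution`. `BlowupResolutionCriterion.lean` reduces "the
blowing up of `X` along an ideal sheaf `J` is a resolution of singularities" to statements about
the affine pieces `J(U_i)` over a Noetherian affine open cover (`Scheme.hasResolution_of_
blowupAlgebra_cover`). In Kato's resolution of a logarithmically regular scheme with a Zariski fs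
ATLAS (`Kato1994_logRegular_hasResolution_general`, `LogRegularAtlas.lean`; Kato 1994 (10.4),
Nizioł 2006 Thm. 5.8) the ideal sheaf is not given: what a subdivision of the fan `F(X)` provides
is, on each chart `U_i`, a monoid ideal `𝔞_i ⊆ P_i`, hence an ideal `I_i = (φ_i(𝔞_i)) ⊆ Γ(X, U_i)`,
and these agree on overlaps because the charts define the same log structure. This file is the
missing scheme-side step, for arbitrary schemes and chart data (nothing specific to log
structures until the last section). Everything is PROVED:

* `exists_idealSheafData_ideal_eq_map_of_compatible`, `exists_idealSheafData_ideal_eq_of_compatible`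
  — **gluing of compatible chart ideals**: affine opens `U_i` covering `X` and ideals
  `I_i ⊆ Γ(X, U_i)` with `I_i · Γ(X, W) = I_j · Γ(X, W)` for every affine open `W ⊆ U_i ∩ U_j`
  are the values `J(U_i) = I_i` of ONE quasi-coherent ideal sheaf `J` (Mathlib
  `Scheme.IdealSheafData`), with `J(W) = I_i · Γ(X, W)` for all affine `W ⊆ U_i`. The glued
  ideal of an affine open `W` consists of the sections whose restriction to every affine
  `W' ⊆ W ∩ U_i` lies in `I_i · Γ(X, W')`; its quasi-coherence (`J(D(f)) = J(W)_f`) is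
  Hartshorne II Prop. 5.4 for the glued sheaf, proved from the compactness of `W` exactly as in
  the tree's `Hironaka2017/Lib/IdealSheafGlueCover.lean` (res-type-089), whose input — ideal
  sheaves already defined on all of `X` — chart data do not supply. No Noetherian,
  quasi-compactness or separatedness hypothesis, arbitrary index type;
* `map_eq_map_of_forall_map_germ_eq` — the compatibility may be checked STALKWISE: ideals over
  an affine open agree iff they generate the same ideal of `𝒪_{X,y}` at every point (Mathlib
  `IsAffineOpen.ideal_ext_iff`); `LogRegularAtlas.map_germ_span_eq_of_mul_chartStalkMonoid_eq` — for an atlas, equal MONOID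
  ideals in the common stalk monoid `M_y ⊆ 𝒪_{X,y}` (`chartStalkMonoid`, `LogRegularAtlas.compat`)
  give equal stalk ideals (the currency of Kato's fan: monoid ideals of `M_y/𝒪^*_{X,y}`);
* `Scheme.hasResolution_of_chartIdeals`, `Scheme.hasResolution_of_chartIdeals_of_germs` — **one-
  blowing-up resolution criterion from chart data**: Noetherian affine cover, compatible chart
  ideals generated by families `x_{ik}`, a non-zero-divisor in each, regular localizations of all
  chart rings `Γ(X, U_i)[I_i/x_{ik}]` ⇒ `Scheme.HasResolution X` (glue, then
  `Scheme.hasResolution_of_blowupAlgebra_cover`: the blowing up along the glued sheaf is proper,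
  Görtz–Wedhorn I Prop. 13.96 (1), birational, Prop. 13.91 (4), and regular, (13.19));
* `Kato1994_logRegular_hasResolution_general_of_charts` — **the atlas form of Kato (10.4) reduced
  to its chart statement**, the twin of `Kato1994_logRegular_hasResolution_of_charts`
  (`LogRegularBlowupCriterion.lean`) for `LogRegularAtlas`: the named fact follows once every
  atlas admits nonempty finite sets of chart monomials `s_i ⊆ P_i`, compatible on overlaps
  (equal ideals of `𝒪_{X,y}`) and with regular blowup-algebra localizations (Kato (10.3));
  the monomials are non-zero-divisors by log regularity (Kato (4.1), Nizioł Lemma 2.4 (1):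
  `LogChart.map_mem_nonZeroDivisors_of_forall_isLogRegularAt`).

## What is NOT here

No fan, no subdivision, no monoid combinatorics: the existence of compatible `s_i` with regular
charts (Kato (9.8) = [KKMS] I Thm. 11 applied to the fan `F(X)` glued from the charts, and
Kato (10.3) on the charts) is the hypothesis `H` of the last theorem, not proved here. No claim
that the resolution is a log blow-up in Nizioł's sense or an isomorphism over the trivial locus.

## Sources (text read: Görtz–Wedhorn I, 2nd ed., Prop. 13.91–13.92 and (13.19); Hartshorne II §5)

* U. Görtz, T. Wedhorn, *Algebraic Geometry I*, 2nd ed. (2020): Prop. 13.91 (4), Prop. 13.92,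
  Prop. 13.96 (1), (13.19) p. 415 — through `BlowupResolutionCriterion.lean`. [GortzWedhorn2020]
* R. Hartshorne, *Algebraic Geometry* (1977): Ch. II Exercise 1.22 (glueing sheaves), Lemma 5.3,
  Prop. 5.4 (quasi-coherence is local), pp. 69, 112–113. [Hartshorne1977]
* K. Kato, *Toric singularities*, Amer. J. Math. 116 (1994): (4.1), (9.6)–(9.9), (10.3), (10.4);
  W. Nizioł, J. Algebraic Geom. 15 (2006), Lemma 2.4, Thm. 5.8 — the statements served.
  [Kato1994] [Niziol2006]
-/

noncomputable section

open AlgebraicGeometry CategoryTheory TopologicalSpace Opposite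
open scoped Pointwise

namespace Literature.AlgebraicGeometry.Resolution

universe u

/-! ## Ideals of an affine open: two localisation facts -/

section AffineOpen

variable {X : Scheme.{u}}

/-- If the restriction of `s ∈ Γ(X, W)` to the basic open `D(g) ⊆ W` (`W` affine) lies in the
extension `J · Γ(X, D(g)) = J_g` of an ideal `J ⊆ Γ(X, W)`, then `gⁿ s ∈ J` for some `n`
(sections over `D(g)` are fractions `x / gᵐ`). [cite: Hartshorne1977, Ch. II Lemma 5.3 (b), p. 112] -/
theorem exists_pow_mul_mem_of_res_mem_map (W : X.affineOpens) (J : Ideal Γ(X, W))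
    (g s : Γ(X, W))
    (h : (X.presheaf.map (homOfLE (X.basicOpen_le g)).op).hom s ∈
      J.map (X.presheaf.map (homOfLE (X.basicOpen_le g)).op).hom) :
    ∃ n : ℕ, g ^ n * s ∈ J := by
  letI := W.2.isLocalization_basicOpen g
  change algebraMap Γ(X, W) Γ(X, X.basicOpen g) s ∈
    J.map (algebraMap Γ(X, W) Γ(X, X.basicOpen g)) at h
  obtain ⟨⟨⟨c, hc⟩, ⟨_, ⟨e, rfl⟩⟩⟩, hce⟩ :=
    (IsLocalization.mem_map_algebraMap_iff (Submonoid.powers g) Γ(X, X.basicOpen g)).1 h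
  simp only at hce
  rw [← map_mul] at hce
  obtain ⟨⟨_, ⟨e', rfl⟩⟩, he'⟩ :=
    (IsLocalization.eq_iff_exists (Submonoid.powers g) Γ(X, X.basicOpen g)).1 hce
  simp only at he'
  refine ⟨e' + e, ?_⟩
  rw [pow_add, mul_assoc, mul_comm (g ^ e) s, he']
  exact Ideal.mul_mem_left _ _ hc

/-- Membership in an ideal `J ⊆ Γ(X, W)` (`W` affine) is local on `W`: if every point of `W`
has a basic open neighbourhood `D(g)` with `s|_{D(g)} ∈ J · Γ(X, D(g))`, then `s ∈ J` (the `g`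
generate the unit ideal and `gⁿ s ∈ J`). [cite: Hartshorne1977, Ch. II Lemma 5.3 and Prop. 5.4, pp. 112–113] -/
theorem mem_of_forall_basicOpen_res_mem_map (W : X.affineOpens) (J : Ideal Γ(X, W))
    (s : Γ(X, W))
    (h : ∀ x ∈ (W : X.Opens), ∃ g : Γ(X, W), x ∈ X.basicOpen g ∧
      (X.presheaf.map (homOfLE (X.basicOpen_le g)).op).hom s ∈
        J.map (X.presheaf.map (homOfLE (X.basicOpen_le g)).op).hom) :
    s ∈ J := by
  choose g hg using h
  let S : Set Γ(X, W) := Set.range fun x : (W : X.Opens) => g x.1 x.2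
  have hspan : Ideal.span S = ⊤ := by
    rw [← W.2.self_le_iSup_basicOpen_iff]
    intro x hx
    exact Opens.mem_iSup.2 ⟨⟨g x hx, ⟨⟨x, hx⟩, rfl⟩⟩, (hg x hx).1⟩
  refine Submodule.mem_of_span_eq_top_of_smul_pow_mem J S hspan s fun r => ?_
  obtain ⟨⟨x, hx⟩, hr⟩ := r.2
  obtain ⟨n, hn⟩ := exists_pow_mul_mem_of_res_mem_map W J (g x hx) s (hg x hx).2
  exact ⟨n, by rw [smul_eq_mul, ← hr]; exact hn⟩

/-- Restriction maps compose (pointwise form).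
[cite: Hartshorne1977, Ch. II §1 Def. of presheaf (restriction maps compose), p. 61] -/
theorem presheaf_map_homOfLE_apply_apply {U U' U'' : X.Opens} (h : U' ≤ U) (h' : U'' ≤ U')
    (s : Γ(X, U)) :
    (X.presheaf.map (homOfLE h').op).hom ((X.presheaf.map (homOfLE h).op).hom s) =
      (X.presheaf.map (homOfLE (h'.trans h)).op).hom s := by
  change ((X.presheaf.map (homOfLE h).op ≫ X.presheaf.map (homOfLE h').op)) s = _
  rw [← X.presheaf.map_comp]
  rfl

/-- Restriction maps compose (ring-hom form).
[cite: Hartshorne1977, Ch. II §1 Def. of presheaf (restriction maps compose), p. 61] -/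
theorem presheaf_map_homOfLE_comp {U U' U'' : X.Opens} (h : U' ≤ U) (h' : U'' ≤ U') :
    (X.presheaf.map (homOfLE h').op).hom.comp (X.presheaf.map (homOfLE h).op).hom =
      (X.presheaf.map (homOfLE (h'.trans h)).op).hom :=
  RingHom.ext fun s => presheaf_map_homOfLE_apply_apply h h' s

/-- Extending an ideal along two successive restrictions is extending it along the composite
restriction. [cite: Hartshorne1977, Ch. II §1 Def. of presheaf (restriction maps compose), p. 61] -/
theorem map_map_presheaf_map_homOfLE {U U' U'' : X.Opens} (h : U' ≤ U) (h' : U'' ≤ U')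
    (J : Ideal Γ(X, U)) :
    (J.map (X.presheaf.map (homOfLE h).op).hom).map (X.presheaf.map (homOfLE h').op).hom =
      J.map (X.presheaf.map (homOfLE (h'.trans h)).op).hom := by
  rw [Ideal.map_map, presheaf_map_homOfLE_comp]

/-- Restriction along `U ≤ U` is the identity.
[cite: Hartshorne1977, Ch. II §1 Def. of presheaf (ρ_UU is the identity), p. 61] -/
theorem presheaf_map_homOfLE_refl_apply {U : X.Opens} (h : U ≤ U) (s : Γ(X, U)) :
    (X.presheaf.map (homOfLE h).op).hom s = s := by
  have : (homOfLE h).op = 𝟙 _ := rfl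
  rw [this, X.presheaf.map_id]
  rfl

/-- Extending an ideal along the identity restriction `U ≤ U` does nothing.
[cite: Hartshorne1977, Ch. II §1 Def. of presheaf (ρ_UU is the identity), p. 61] -/
theorem map_presheaf_map_homOfLE_refl {U : X.Opens} (h : U ≤ U) (J : Ideal Γ(X, U)) :
    J.map (X.presheaf.map (homOfLE h).op).hom = J := by
  have hid : (X.presheaf.map (homOfLE h).op).hom = RingHom.id _ :=
    RingHom.ext fun s => presheaf_map_homOfLE_refl_apply h s
  rw [hid, Ideal.map_id]

end AffineOpen

/-! ## Gluing compatible chart ideals to one quasi-coherent ideal sheaf -/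

section Glue

variable {X : Scheme.{u}}

/-- **Gluing of compatible chart ideals.** Let `U_i` be affine opens covering the scheme `X`
and `I_i ⊆ Γ(X, U_i)` ideals which AGREE ON THE OVERLAPS: for every affine open `W ⊆ U_i ∩ U_j`
the extended ideals `I_i · Γ(X, W)` and `I_j · Γ(X, W)` coincide. Then there is ONE
quasi-coherent ideal sheaf `J` on `X` (Mathlib `Scheme.IdealSheafData`) with
`J(W) = I_i · Γ(X, W)` for every affine open `W ⊆ U_i` — in particular `J(U_i) = I_i`. (The
sections of `J` over an affine open `W` are the `t ∈ Γ(X, W)` whose restriction to every affine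
`W' ⊆ W ∩ U_i` lies in `I_i · Γ(X, W')`; quasi-coherence of this glued sheaf of ideals is local:
Hartshorne II Prop. 5.4, proved exactly as in the tree's `IdealSheafGlueCover.glue`, from the
compactness of affine opens.) No Noetherian or separatedness hypothesis; arbitrary index type.
[cite: Hartshorne1977, Ch. II Exercise 1.22 (glueing sheaves) with Prop. 5.4, pp. 69, 113] -/
theorem exists_idealSheafData_ideal_eq_map_of_compatible {ι : Type*} (U : ι → X.affineOpens)
    (hU : ∀ x : X, ∃ i, x ∈ (U i : X.Opens)) (I : ∀ i, Ideal Γ(X, U i))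
    (hI : ∀ (i j : ι) (W : X.affineOpens) (hi : (W : X.Opens) ≤ U i) (hj : (W : X.Opens) ≤ U j),
      (I i).map (X.presheaf.map (homOfLE hi).op).hom =
        (I j).map (X.presheaf.map (homOfLE hj).op).hom) :
    ∃ J : X.IdealSheafData, ∀ (i : ι) (W : X.affineOpens) (h : (W : X.Opens) ≤ U i),
      J.ideal W = (I i).map (X.presheaf.map (homOfLE h).op).hom := by
  classical
  -- the glued family of ideals
  let G : ∀ W : X.affineOpens, Ideal Γ(X, W) := fun W =>
    ⨅ (i : ι), ⨅ (W' : X.affineOpens), ⨅ (h : (W' : X.Opens) ≤ (W : X.Opens) ⊓ U i),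
      ((I i).map (X.presheaf.map (homOfLE (le_trans h inf_le_right)).op).hom).comap
        (X.presheaf.map (homOfLE (le_trans h inf_le_left)).op).hom
  have hmem : ∀ (W : X.affineOpens) (t : Γ(X, W)), t ∈ G W ↔ ∀ (i : ι) (W' : X.affineOpens)
      (h : (W' : X.Opens) ≤ (W : X.Opens) ⊓ U i),
      (X.presheaf.map (homOfLE (le_trans h inf_le_left)).op).hom t ∈
        (I i).map (X.presheaf.map (homOfLE (le_trans h inf_le_right)).op).hom := by
    intro W t
    simp only [G, Ideal.mem_iInf, Ideal.mem_comap]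
  -- the glued ideals restrict into each other
  have hres : ∀ (W W₁ : X.affineOpens) (hW : (W₁ : X.Opens) ≤ W) (t : Γ(X, W)), t ∈ G W →
      (X.presheaf.map (homOfLE hW).op).hom t ∈ G W₁ := by
    intro W W₁ hW t ht
    rw [hmem] at ht ⊢
    intro i W' h
    rw [presheaf_map_homOfLE_apply_apply]
    exact ht i W' (le_inf ((h.trans inf_le_left).trans hW) (h.trans inf_le_right))
  -- on an affine open inside `U i` the glued ideal is the extension of `I i`
  have heq : ∀ (i : ι) (W : X.affineOpens) (hW : (W : X.Opens) ≤ U i),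
      G W = (I i).map (X.presheaf.map (homOfLE hW).op).hom := by
    intro i W hW
    apply le_antisymm
    · intro t ht
      rw [hmem] at ht
      have := ht i W (le_inf le_rfl hW)
      rwa [presheaf_map_homOfLE_refl_apply] at this
    · intro t ht
      rw [hmem]
      intro j W' h
      rw [← hI i j W' ((h.trans inf_le_left).trans hW) (h.trans inf_le_right),
        ← map_map_presheaf_map_homOfLE hW (h.trans inf_le_left)]
      exact Ideal.mem_map_of_mem _ ht
  -- quasi-coherence of the glued family (Hartshorne II 5.4 for the glued sheaf)
  have hqc : ∀ (W : X.affineOpens) (f : Γ(X, W)),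
      G (X.affineBasicOpen f) ≤ (G W).map (X.presheaf.map (homOfLE (X.basicOpen_le f)).op).hom := by
    intro W f t ht
    change Γ(X, X.basicOpen f) at t
    letI := W.2.isLocalization_basicOpen f
    -- `t * f^m = a` with `a ∈ Γ(X, W)`
    obtain ⟨⟨a, ⟨_, ⟨m, rfl⟩⟩⟩, hat⟩ :=
      IsLocalization.surj (M := Submonoid.powers f) (S := Γ(X, X.basicOpen f)) t
    simp only at hat
    -- a finite cover of `W` by affine opens inside some `W ∩ U i`
    have hcov : ∀ x ∈ (W : Set X), ∃ q : Σ i, X.affineOpens,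
        (q.2 : X.Opens) ≤ (W : X.Opens) ⊓ U q.1 ∧ x ∈ (q.2 : X.Opens) := by
      intro x hx
      obtain ⟨i, hi⟩ := hU x
      obtain ⟨W₀, hW₀, hxW₀, hW₀U⟩ :=
        exists_isAffineOpen_mem_and_subset (U := (W : X.Opens) ⊓ U i) ⟨hx, hi⟩
      exact ⟨⟨i, ⟨W₀, hW₀⟩⟩, hW₀U, hxW₀⟩
    let Q := {q : Σ i, X.affineOpens // (q.2 : X.Opens) ≤ (W : X.Opens) ⊓ U q.1}
    obtain ⟨T, hT⟩ := W.2.isCompact.elim_finite_subcover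
      (fun q : Q => ((q.1.2 : X.Opens) : Set X)) (fun q => (q.1.2 : X.Opens).2) (fun x hx => by
        obtain ⟨q, hq, hxq⟩ := hcov x hx
        exact Set.mem_iUnion.2 ⟨⟨q, hq⟩, hxq⟩)
    -- on each member of the cover, `f^d a` restricts into the chart ideal
    have hloc : ∀ q : Q, ∃ d : ℕ,
        (X.presheaf.map (homOfLE (le_trans q.2 inf_le_left)).op).hom (f ^ d * a) ∈
          (I q.1.1).map (X.presheaf.map (homOfLE (le_trans q.2 inf_le_right)).op).hom := by
      rintro ⟨⟨i, W₀⟩, hW₀⟩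
      have hW₀W : (W₀ : X.Opens) ≤ W := hW₀.trans inf_le_left
      have hW₀i : (W₀ : X.Opens) ≤ U i := hW₀.trans inf_le_right
      -- the basic open of `f|_{W₀}` inside `W₀`
      let fW : Γ(X, W₀) := (X.presheaf.map (homOfLE hW₀W).op).hom f
      have hD : X.basicOpen fW = (W₀ : X.Opens) ⊓ X.basicOpen f := Scheme.basicOpen_res _ _ _
      have hDle : X.basicOpen fW ≤ X.basicOpen f := hD.trans_le inf_le_right
      have hDle' : (X.affineBasicOpen fW : X.Opens) ≤ (X.affineBasicOpen f : X.Opens) ⊓ U i :=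
        le_inf hDle ((hD.trans_le inf_le_left).trans hW₀i)
      have h1 : (X.presheaf.map (homOfLE hDle).op).hom t ∈
          (I i).map (X.presheaf.map (homOfLE ((X.basicOpen_le fW).trans hW₀i)).op).hom :=
        (hmem _ t).1 ht i (X.affineBasicOpen fW) hDle'
      -- hence the restriction of `a = t f^m` lies there too
      have h2 : (X.presheaf.map (homOfLE (X.basicOpen_le fW)).op).hom
            ((X.presheaf.map (homOfLE hW₀W).op).hom a) ∈
          ((I i).map (X.presheaf.map (homOfLE hW₀i).op).hom).map
            (X.presheaf.map (homOfLE (X.basicOpen_le fW)).op).hom := by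
        rw [map_map_presheaf_map_homOfLE, presheaf_map_homOfLE_apply_apply,
          ← presheaf_map_homOfLE_apply_apply (X.basicOpen_le f) hDle]
        change (X.presheaf.map (homOfLE hDle).op).hom
          (algebraMap Γ(X, W) Γ(X, X.basicOpen f) a) ∈ _
        rw [← hat, map_mul]
        exact Ideal.mul_mem_right _ _ h1
      obtain ⟨d, hd⟩ := exists_pow_mul_mem_of_res_mem_map W₀ _ fW _ h2
      refine ⟨d, ?_⟩
      change (X.presheaf.map (homOfLE hW₀W).op).hom (f ^ d * a) ∈
        (I i).map (X.presheaf.map (homOfLE hW₀i).op).hom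
      rw [map_mul, map_pow]
      exact hd
    choose d hd using hloc
    -- a common exponent
    let M : ℕ := T.sup d
    have hM : ∀ q ∈ T,
        (X.presheaf.map (homOfLE (le_trans q.2 inf_le_left)).op).hom (f ^ M * a) ∈
          (I q.1.1).map (X.presheaf.map (homOfLE (le_trans q.2 inf_le_right)).op).hom := by
      intro q hq
      have hle : d q ≤ M := Finset.le_sup hq
      obtain ⟨c, hc⟩ := Nat.exists_eq_add_of_le hle
      rw [hc, add_comm, pow_add, mul_assoc, map_mul]
      exact Ideal.mul_mem_left _ _ (hd q)
    -- `f^M a` lies in the glued ideal of `W`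
    have hfa : f ^ M * a ∈ G W := by
      rw [hmem]
      intro i W' hW'
      apply mem_of_forall_basicOpen_res_mem_map
      intro x hx
      -- `x` lies in some member `W₀` of the finite cover
      have hxW : x ∈ (W : Set X) := hW'.trans inf_le_left hx
      obtain ⟨q, hqT, hxq⟩ : ∃ q ∈ T, x ∈ ((q.1.2 : X.Opens) : Set X) := by
        simpa only [Set.mem_iUnion, exists_prop] using hT hxW
      -- a basic open of `W'` around `x` inside `W₀`
      obtain ⟨g, hgW₀, hxg⟩ := W'.2.exists_basicOpen_le ⟨x, hxq⟩ hx
      refine ⟨g, hxg, ?_⟩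
      have hgi : X.basicOpen g ≤ (U i : X.Opens) :=
        (X.basicOpen_le g).trans (hW'.trans inf_le_right)
      have hgq : X.basicOpen g ≤ (U q.1.1 : X.Opens) :=
        hgW₀.trans (le_trans q.2 inf_le_right)
      -- compatibility on the affine open `D(g) ⊆ U i ∩ U q`
      have e : (I i).map (X.presheaf.map (homOfLE hgi).op).hom =
          (I q.1.1).map (X.presheaf.map (homOfLE hgq).op).hom :=
        hI i q.1.1 (X.affineBasicOpen g) hgi hgq
      rw [map_map_presheaf_map_homOfLE, presheaf_map_homOfLE_apply_apply, e,
        ← presheaf_map_homOfLE_apply_apply (le_trans q.2 inf_le_left) hgW₀,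
        ← map_map_presheaf_map_homOfLE (le_trans q.2 inf_le_right) hgW₀]
      exact Ideal.mem_map_of_mem _ (hM q hqT)
    -- conclude: `t = (f^M a)|_{D(f)} · (f|)^{-(M+m)}`
    have hunit : IsUnit (algebraMap Γ(X, W) Γ(X, X.basicOpen f) (f ^ (M + m))) :=
      IsLocalization.map_units (M := Submonoid.powers f) Γ(X, X.basicOpen f) ⟨f ^ (M + m), M + m, rfl⟩
    obtain ⟨v, hv⟩ := hunit
    have key : algebraMap Γ(X, W) Γ(X, X.basicOpen f) (f ^ M) *
        algebraMap Γ(X, W) Γ(X, X.basicOpen f) (f ^ m) * (↑v⁻¹ : Γ(X, X.basicOpen f)) = 1 := by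
      rw [← map_mul, ← pow_add, ← hv, Units.mul_inv]
    have ht' : t = algebraMap Γ(X, W) Γ(X, X.basicOpen f) (f ^ M * a) *
        (↑v⁻¹ : Γ(X, X.basicOpen f)) := by
      calc t = t * 1 := (mul_one _).symm
        _ = t * (algebraMap Γ(X, W) Γ(X, X.basicOpen f) (f ^ M) *
              algebraMap Γ(X, W) Γ(X, X.basicOpen f) (f ^ m) *
              (↑v⁻¹ : Γ(X, X.basicOpen f))) := by rw [key]
        _ = algebraMap Γ(X, W) Γ(X, X.basicOpen f) (f ^ M * a) *
              (↑v⁻¹ : Γ(X, X.basicOpen f)) := by rw [map_mul, ← hat]; ring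
    have : t ∈ (G W).map (X.presheaf.map (homOfLE (X.basicOpen_le f)).op).hom := by
      rw [ht']
      exact Ideal.mul_mem_right _ _ (Ideal.mem_map_of_mem _ hfa)
    exact this
  refine ⟨{ ideal := G
            map_ideal_basicOpen := fun W f => le_antisymm ?_ (hqc W f) }, heq⟩
  rw [Ideal.map_le_iff_le_comap]
  intro t ht
  exact hres W (X.affineBasicOpen f) (X.basicOpen_le f) t ht

/-- **Gluing of compatible chart ideals**, value on the charts: under the hypotheses of
`exists_idealSheafData_ideal_eq_map_of_compatible` there is an ideal sheaf `J` on `X` with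
`J(U_i) = I_i` for every `i`. [cite: Hartshorne1977, Ch. II Exercise 1.22 with Prop. 5.4, pp. 69, 113] -/
theorem exists_idealSheafData_ideal_eq_of_compatible {ι : Type*} (U : ι → X.affineOpens)
    (hU : ∀ x : X, ∃ i, x ∈ (U i : X.Opens)) (I : ∀ i, Ideal Γ(X, U i))
    (hI : ∀ (i j : ι) (W : X.affineOpens) (hi : (W : X.Opens) ≤ U i) (hj : (W : X.Opens) ≤ U j),
      (I i).map (X.presheaf.map (homOfLE hi).op).hom =
        (I j).map (X.presheaf.map (homOfLE hj).op).hom) :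
    ∃ J : X.IdealSheafData, ∀ i, J.ideal (U i) = I i := by
  obtain ⟨J, hJ⟩ := exists_idealSheafData_ideal_eq_map_of_compatible U hU I hI
  exact ⟨J, fun i => by rw [hJ i (U i) le_rfl, map_presheaf_map_homOfLE_refl]⟩

end Glue

/-! ## Compatibility on overlaps, stalkwise -/

section Stalks

variable {X : Scheme.{u}}

/-- **Ideals over an affine open agree iff they agree in every stalk** (Mathlib
`IsAffineOpen.ideal_ext_iff`), in the form needed for chart data: two ideals `I₁ ⊆ Γ(X, U₁)`,
`I₂ ⊆ Γ(X, U₂)` whose images generate the same ideal of `𝒪_{X,y}` at every point `y` of an affine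
open `W ⊆ U₁ ∩ U₂` have the same extension to `Γ(X, W)`. [cite: Hartshorne1977, Ch. II Prop. 5.4 and Ex. 5.2–5.3, p. 113] -/
theorem map_eq_map_of_forall_map_germ_eq (W : X.affineOpens) {U₁ U₂ : X.Opens}
    (h₁ : (W : X.Opens) ≤ U₁) (h₂ : (W : X.Opens) ≤ U₂) (I₁ : Ideal Γ(X, U₁)) (I₂ : Ideal Γ(X, U₂))
    (h : ∀ (y : X) (hy : y ∈ (W : X.Opens)),
      I₁.map (X.presheaf.germ U₁ y (h₁ hy)).hom = I₂.map (X.presheaf.germ U₂ y (h₂ hy)).hom) :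
    I₁.map (X.presheaf.map (homOfLE h₁).op).hom = I₂.map (X.presheaf.map (homOfLE h₂).op).hom := by
  rw [W.2.ideal_ext_iff]
  intro y hy
  rw [Ideal.map_map, Ideal.map_map, ← CommRingCat.hom_comp, ← CommRingCat.hom_comp,
    X.presheaf.germ_res (homOfLE h₁) y hy, X.presheaf.germ_res (homOfLE h₂) y hy]
  exact h y hy

/-- **An ideal is generated by a set of generators together with any submonoid of multipliers**:
if `S · M = T · M` as subsets of `R` for a submonoid `M ⊆ R` (e.g. two sets of monomials
generating the same monoid ideal of a monoid `M ⊆ (R, ·)`), then `S` and `T` generate the same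
ideal of `R`. [folklore] -/
private theorem span_eq_span_of_mul_submonoid_eq {R : Type*} [CommSemiring R] (M : Submonoid R)
    {S T : Set R} (h : S * (M : Set R) = T * (M : Set R)) : Ideal.span S = Ideal.span T := by
  have key : ∀ S : Set R, Ideal.span S = Ideal.span (S * (M : Set R)) := fun S => by
    apply le_antisymm
    · exact Ideal.span_mono fun s hs => Set.mem_mul.2 ⟨s, hs, 1, M.one_mem, mul_one s⟩
    · refine Ideal.span_le.2 ?_
      rintro _ ⟨s, hs, m, -, rfl⟩
      exact Ideal.mul_mem_right _ _ (Ideal.subset_span hs)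
  rw [key S, key T, h]

/-- **From equal monoid ideals in the common stalk monoid to equal stalk ideals.** For a
log-regular atlas `𝒜` on `X` (charts `φ_i : P_i → Γ(X, U_i)` defining the same stalk monoids
`M_y ⊆ 𝒪_{X,y}` on overlaps, `LogRegularAtlas.compat`) and sets `s_i ⊆ P_i`, `s_j ⊆ P_j`: if at
`y ∈ U_i ∩ U_j` the germs of `φ_i(s_i)` and of `φ_j(s_j)` generate the same monoid ideal of `M_y`
(`germs · M_y` coincide as subsets of `𝒪_{X,y}`), then the ideals `(φ_i(s_i))` and `(φ_j(s_j))`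
generate the same ideal of `𝒪_{X,y}` — the compatibility hypothesis of
`Kato1994_logRegular_hasResolution_general_of_charts` below, in the currency of Kato's fan
(monoid ideals of `M_y / 𝒪_{X,y}^*`). [cite: Kato1994, (9.6)–(9.9) and (10.4)] -/
theorem LogRegularAtlas.map_germ_span_eq_of_mul_chartStalkMonoid_eq (𝒜 : LogRegularAtlas X)
    {i j : 𝒜.ι} {y : X} (hi : y ∈ (𝒜.U i : X.Opens)) (hj : y ∈ (𝒜.U j : X.Opens))
    (sᵢ : Set (𝒜.P i)) (sⱼ : Set (𝒜.P j))
    (h : ((fun p : 𝒜.P i => (X.presheaf.germ (𝒜.U i : X.Opens) y hi).hom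
          (𝒜.φ i (Multiplicative.ofAdd p))) '' sᵢ) *
        (chartStalkMonoid (𝒜.U i : X.Opens) (𝒜.φ i) y hi : Set (X.presheaf.stalk y)) =
      ((fun p : 𝒜.P j => (X.presheaf.germ (𝒜.U j : X.Opens) y hj).hom
          (𝒜.φ j (Multiplicative.ofAdd p))) '' sⱼ) *
        (chartStalkMonoid (𝒜.U j : X.Opens) (𝒜.φ j) y hj : Set (X.presheaf.stalk y))) :
    (Ideal.span ((fun p : 𝒜.P i => 𝒜.φ i (Multiplicative.ofAdd p)) '' sᵢ)).map
        (X.presheaf.germ (𝒜.U i : X.Opens) y hi).hom =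
      (Ideal.span ((fun p : 𝒜.P j => 𝒜.φ j (Multiplicative.ofAdd p)) '' sⱼ)).map
        (X.presheaf.germ (𝒜.U j : X.Opens) y hj).hom := by
  rw [Ideal.map_span, Ideal.map_span, Set.image_image, Set.image_image]
  rw [← 𝒜.compat i j y hi hj] at h
  exact span_eq_span_of_mul_submonoid_eq _ h

end Stalks

/-! ## Assembly: a resolution of singularities from compatible chart ideals -/

section Assembly

variable {X : Scheme.{u}}

/-- **One-blowing-up resolution criterion from CHART data.** Let `X = ⋃_i U_i` be an affine
open cover with Noetherian coordinate rings, and on each chart an ideal `I_i ⊆ Γ(X, U_i)`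
generated by a family `x_{ik}` and containing a non-zero-divisor `a_i`, such that
(compatibility) `I_i · Γ(X, W) = I_j · Γ(X, W)` for every affine open `W ⊆ U_i ∩ U_j`, and
(chart regularity) every localization at a prime of every affine blowup algebra
`Γ(X, U_i)[I_i/x_{ik}]` is a regular local ring. Then `X` has a resolution of singularities:
the `I_i` glue to ONE ideal sheaf `J` with `J(U_i) = I_i`
(`exists_idealSheafData_ideal_eq_of_compatible`) and the blowing up of `X` along `J` is a
resolution (`Scheme.hasResolution_of_blowupAlgebra_cover`: proper, Görtz–Wedhorn Prop. 13.96 (1);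
birational, Prop. 13.91 (4); regular by the charts (13.19)).
[cite: GortzWedhorn2020, Prop. 13.91 (4), Prop. 13.92, (13.19) p. 415] [cite: Hartshorne1977, Ch. II Ex. 1.22, Prop. 5.4] -/
theorem Scheme.hasResolution_of_chartIdeals {ι : Type*} (U : ι → X.affineOpens)
    (hU : ⨆ i, (U i : X.Opens) = ⊤) [∀ i, IsNoetherianRing Γ(X, U i)]
    (I : ∀ i, Ideal Γ(X, U i))
    (hI : ∀ (i j : ι) (W : X.affineOpens) (hi : (W : X.Opens) ≤ U i) (hj : (W : X.Opens) ≤ U j),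
      (I i).map (X.presheaf.map (homOfLE hi).op).hom =
        (I j).map (X.presheaf.map (homOfLE hj).op).hom)
    {κ : ι → Type*} (x : ∀ i, κ i → Γ(X, U i)) (hxI : ∀ i k, x i k ∈ I i)
    (hIx : ∀ i, I i ≤ Ideal.span (Set.range (x i)))
    (a : ∀ i, Γ(X, U i)) (haI : ∀ i, a i ∈ I i) (ha : ∀ i, a i ∈ nonZeroDivisors Γ(X, U i))
    (hreg : ∀ i k (𝔓 : Ideal (blowupAlgebra (I i) (x i k))) [𝔓.IsPrime],
      IsRegularLocalRing (Localization.AtPrime 𝔓)) :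
    Scheme.HasResolution X := by
  have hU' : ∀ y : X, ∃ i, y ∈ (U i : X.Opens) := fun y => by
    have hy : y ∈ ⨆ i, (U i : X.Opens) := by rw [hU]; trivial
    exact Opens.mem_iSup.mp hy
  obtain ⟨J, hJ⟩ := exists_idealSheafData_ideal_eq_of_compatible U hU' I hI
  have hreg' : ∀ i k (𝔓 : Ideal (blowupAlgebra (J.ideal (U i)) (x i k))) [𝔓.IsPrime],
      IsRegularLocalRing (Localization.AtPrime 𝔓) := by
    intro i
    rw [hJ i]
    exact hreg i
  exact Scheme.hasResolution_of_blowupAlgebra_cover U hU J x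
    (fun i k => by rw [hJ i]; exact hxI i k) (fun i => by rw [hJ i]; exact hIx i) a
    (fun i => by rw [hJ i]; exact haI i) ha hreg'

/-- **One-blowing-up resolution criterion from chart data, stalkwise compatibility**: as
`Scheme.hasResolution_of_chartIdeals`, with the compatibility of the chart ideals stated at the
points — at every `y ∈ U_i ∩ U_j` the ideals of `𝒪_{X,y}` generated by `I_i` and by `I_j`
coincide (`map_eq_map_of_forall_map_germ_eq`).
[cite: GortzWedhorn2020, Prop. 13.91 (4), Prop. 13.92, (13.19) p. 415] [cite: Hartshorne1977, Ch. II Ex. 1.22, Prop. 5.4] -/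
theorem Scheme.hasResolution_of_chartIdeals_of_germs {ι : Type*} (U : ι → X.affineOpens)
    (hU : ⨆ i, (U i : X.Opens) = ⊤) [∀ i, IsNoetherianRing Γ(X, U i)]
    (I : ∀ i, Ideal Γ(X, U i))
    (hI : ∀ (i j : ι) (y : X) (hi : y ∈ (U i : X.Opens)) (hj : y ∈ (U j : X.Opens)),
      (I i).map (X.presheaf.germ (U i : X.Opens) y hi).hom =
        (I j).map (X.presheaf.germ (U j : X.Opens) y hj).hom)
    {κ : ι → Type*} (x : ∀ i, κ i → Γ(X, U i)) (hxI : ∀ i k, x i k ∈ I i)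
    (hIx : ∀ i, I i ≤ Ideal.span (Set.range (x i)))
    (a : ∀ i, Γ(X, U i)) (haI : ∀ i, a i ∈ I i) (ha : ∀ i, a i ∈ nonZeroDivisors Γ(X, U i))
    (hreg : ∀ i k (𝔓 : Ideal (blowupAlgebra (I i) (x i k))) [𝔓.IsPrime],
      IsRegularLocalRing (Localization.AtPrime 𝔓)) :
    Scheme.HasResolution X :=
  Scheme.hasResolution_of_chartIdeals U hU I
    (fun i j W hi hj => map_eq_map_of_forall_map_germ_eq W hi hj (I i) (I j)
      fun y hy => hI i j y (hi hy) (hj hy))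
    x hxI hIx a haI ha hreg

end Assembly

/-! ## Kato 1994 (10.4), atlas form, reduced to its chart statement -/

section Kato

/-- **`Kato1994_logRegular_hasResolution_general` reduced to its chart statement** (the atlas
twin of `Kato1994_logRegular_hasResolution_of_charts`). The named fact (`LogRegularAtlas.lean`:
a scheme with a log-regular Zariski fs atlas has a resolution of singularities) follows as soon
as, for every atlas `𝒜` on `X`, SOME nonempty finite sets `s_i ⊆ P_i` of chart monomials
(i) are compatible on overlaps — at every `y ∈ U_i ∩ U_j` the monomials `φ_i(s_i)` and
`φ_j(s_j)` generate the same ideal of `𝒪_{X,y}` (for monoid ideals read off ONE subdivision of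
Kato's fan `F(X)` this is `LogRegularAtlas.map_germ_span_eq_of_mul_chartStalkMonoid_eq`) — and
(ii) have all the blowup algebras `Γ(X, U_i)[(φ_i(s_i))/φ_i(a)]`, `a ∈ s_i`, with regular
localizations (Kato (10.3) on the charts of `X' = X ×_{F(X)} F'`). The monomials are
non-zero-divisors by log regularity (`LogChart.map_mem_nonZeroDivisors_of_forall_isLogRegularAt`,
Kato (4.1) / Nizioł Lemma 2.4), so `Scheme.hasResolution_of_chartIdeals_of_germs` applies: the
chart ideals glue to one ideal sheaf and its blowing up resolves `X`.
[cite: Kato1994, (10.4) with (9.8), (9.11), (10.3)] [cite: Niziol2006, Thm. 5.8] -/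
theorem Kato1994_logRegular_hasResolution_general_of_charts
    (H : ∀ (X : Scheme.{u}) (𝒜 : LogRegularAtlas X), ∃ s : ∀ i, Finset (𝒜.P i),
      (∀ i, (s i).Nonempty) ∧
      (∀ (i j : 𝒜.ι) (y : X) (hi : y ∈ (𝒜.U i : X.Opens)) (hj : y ∈ (𝒜.U j : X.Opens)),
        (Ideal.span ((fun p : 𝒜.P i => 𝒜.φ i (Multiplicative.ofAdd p)) '' (s i : Set (𝒜.P i)))).map
            (X.presheaf.germ (𝒜.U i : X.Opens) y hi).hom =
          (Ideal.span ((fun p : 𝒜.P j => 𝒜.φ j (Multiplicative.ofAdd p)) '' (s j : Set (𝒜.P j)))).map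
            (X.presheaf.germ (𝒜.U j : X.Opens) y hj).hom) ∧
      (∀ i, ∀ a ∈ s i, ∀ (𝔓 : Ideal (blowupAlgebra
          (Ideal.span ((fun p : 𝒜.P i => 𝒜.φ i (Multiplicative.ofAdd p)) '' (s i : Set (𝒜.P i))))
          (𝒜.φ i (Multiplicative.ofAdd a)))) [𝔓.IsPrime],
        IsRegularLocalRing (Localization.AtPrime 𝔓))) :
    Kato1994_logRegular_hasResolution_general.{u} := by
  rintro X ⟨𝒜⟩
  obtain ⟨s, hs, hcompat, hreg⟩ := H X 𝒜
  haveI : ∀ i, IsNoetherianRing Γ(X, (𝒜.U i : X.Opens)) := 𝒜.isNoetherianRing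
  choose a₀ ha₀ using hs
  refine Scheme.hasResolution_of_chartIdeals_of_germs 𝒜.U 𝒜.iSup_eq_top
    (fun i => Ideal.span ((fun p : 𝒜.P i => 𝒜.φ i (Multiplicative.ofAdd p)) '' (s i : Set (𝒜.P i))))
    hcompat (κ := fun i => ↥(s i)) (fun i a => 𝒜.φ i (Multiplicative.ofAdd (a : 𝒜.P i)))
    (fun i a => Ideal.subset_span ⟨a, a.2, rfl⟩) (fun i => Ideal.span_le.2 ?_)
    (fun i => 𝒜.φ i (Multiplicative.ofAdd (a₀ i))) (fun i => Ideal.subset_span ⟨a₀ i, ha₀ i, rfl⟩)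
    (fun i => LogChart.map_mem_nonZeroDivisors_of_forall_isLogRegularAt (𝒜.fg i) (𝒜.saturated i)
      (fun 𝔭 _ => 𝒜.isLogRegularAt i 𝔭) (a₀ i))
    (fun i a 𝔓 _ => hreg i a a.2 𝔓)
  rintro _ ⟨p, hp, rfl⟩
  exact Ideal.subset_span ⟨⟨p, hp⟩, rfl⟩

end Kato

end Literature.AlgebraicGeometry.Resolution

end
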